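import Mathlib
import Summits.NavierStokesRegularity.NavierStokesRegularity.Theorems.TypeIQuarterGateScarEnvelopeTypeISatelliteTowerHullCells
import Summits.NavierStokesRegularity.NavierStokesRegularity.Theorems.TypeIQuarterGateScarEnvelopeTypeISatelliteTowerClosure
import Summits.NavierStokesRegularity.NavierStokesRegularity.Theorems.TypeIQuarterGateScarEnvelopeTypeISatelliteTowerGalleryRecurrence
import Summits.NavierStokesRegularity.NavierStokesRegularity.Theorems.TypeIQuarterGateScarEnvelopeTypeIScarSetTopology
import Summits.NavierStokesRegularity.NavierStokesRegularity.Theorems.RecurrentProfilesRecurrentLiouvillePrBlowupDichotomy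
import Summits.NavierStokesRegularity.NavierStokesRegularity.Theorems.RecurrentProfilesRecurrentLiouvillePrScalingStabilizer
import Summits.NavierStokesRegularity.NavierStokesRegularity.Theorems.SqueezeCycleRecurrentLiouvilleNearIdentityDSS
import Summits.NavierStokesRegularity.NavierStokesRegularity.Theorems.RecurrentProfilesRecurrentReductionOrbit
import Literature.Analysis.FluidPDE.TypeIRateClassicalRepresentative
import Literature.Analysis.FluidPDE.TypeIAncientMildRescale
import Literature.Analysis.FluidPDE.ScalingUniformRecurrence
import Literature.Analysis.FluidPDE.TypeIAncientMildClassical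
import Literature.Analysis.FluidPDE.PineauVicolRSSChaeWolf
import Literature.Analysis.FluidPDE.NSLerayStrongLocalExistence
import Literature.Barriers.NavierStokesRegularity.NearOneDssTypeIExclusion
import Summits.NavierStokesRegularity.NavierStokesRegularity.Theorems.RecurrentProfilesRecurrentLiouvillePrRecurrentHullSymmetric
import Literature.Dynamics.TopologicalDynamics.MinimalOrbitClosure
import Mathlib.Topology.Metrizable.Uniformity
import Summits.NavierStokesRegularity.NavierStokesRegularity.Theorems.ChiralWindowDoorClassDerivDecay

/-!
# Satellite tower for crux `ScarEnvelopeTypeI` (stmt-NavierStokesRegularity-23843) — ROUND-45 Part D: THE ONE-SLICE METER (Pineau–Vicol 2026 Thm 1.9 BY NAME on enveloped rooted census objects: Z16 defect floor; Z17 all scales under the pressure envelope; Z17⁺ W45-π discharged by name; Z17⁺⁺ unconditional meter; Z18 the meter on the tame DSS cell)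

Part D of nsreg-p3 g28's ROUND-45 artefact (landing form (25d); ref3 R44-F3 / DIRECTOR-NS #262: the R44 §6 seed (ι), typed): Z16 ★★
`oneSlice_defect_floor` (contrapositive of the PROVED tree theorem `pineauVicol2026_oneSlice_regularity_holds` + the `RegPt` bridge);
`annulusBound_of_pressureEnvelope`; Z17 ★★ `oneSlice_defect_floor_allScales` (scale covariance: `IsClassicalNSSolutionOn.nsRescale_holds`,
`HasTypeIDecay.nsRescale`, `regPt_of_regPt_zoom_zero`); Z17⁺ ★ `pressureEnvelope_of_hasTypeIDecay` (W45-π BY NAME from the tree's KNSS package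
`ChiralWindowDoorClassDerivDecay.exists_classical_scaleInvariantBounds_of_class`); Z17⁺⁺ ★★ `oneSlice_speedFloor_of_envelope` (UNCONDITIONAL meter on
enveloped rooted Type-I ancient mild fields, every scale); Z18 ★★ `tameDssCell_speedFloor` (the meter on ROUND-44's tame DSS cell, Z5⁺ envelope).
A METER (quantitative rigidity constraint), not an exclusion: PV26 Thm 1.9 kills no cell by itself; item 23843 is OPEN.

PROVENANCE: declaration texts VERBATIM from the HOME artefact of the instrument seat nsreg-p3 g28 (cell `pub/ns-regularity-ideate`):
`round-45/Birkhoff45.lean` (sha16 `f8170ff5aabdcd25`, parts `partA45…partD45.lean`; a module written against the TREE, importing route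
RecurrentProfiles' crux-1589 dynamics modules and the Literature dynamics BY NAME; its Part Z = ROUND-44 is already in the tree as
`…SatelliteTowerHullJunction/…HullDichotomy/…DssNecklace/…DssCell/…HullCells/…HullEdge`, p664756…p666018), scored by referee ref3
(`SCORE-p3-ROUND-45-0828.md` cba78f676c9340cc, PASS TEXT+LEAN ★★ 21:02:16Z); the author cannot write under `Theorems/` (`perm.theorems-prover-only`); landed by the prover
ns-es-p1 g6 as landing hand of record (director-ns DIRECTOR-NS #237 (3)), split into ≤ 400-line modules, the artefact's
`#guard_msgs … #print axioms` certificates not landed.  `--supports stmt-NavierStokesRegularity-23843 --as helper`.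

HONEST FRAMING: NORMAL FORM / JUNCTION / MECHANISM / METER theorems about HYPOTHETICAL Type-I zoom limits (Albritton–Barker objects of
the census of crux `TypeIQuarterGate.ScarEnvelopeTypeI`, item 23843).  Movement 0 on anything open: item 23843, route TypeIQuarterGate,
crux 1589 `RecurrentLiouville`, crux 22144 `FiniteDissipationLiouville`, the statements (ρ), (θ′), (υ), the DSS cells (τ), (κ), N0 and
Navier–Stokes regularity are all OPEN — NS regularity is NOT proved here.  IN-TREE DISCLOSURE (cited by name, not re-derived):
Furstenberg 1981 Thms 1.15/1.17 (`Literature/Dynamics/TopologicalDynamics/{UniformRecurrence,MinimalOrbitClosure}.lean`), the `L³_loc`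
slab-field model `SlabField` (`Literature/Analysis/FluidPDE/ScalingRecurrentSlabField.lean`), `exists_orbit_limit` (Albritton–Barker
compactness), `stub_prJointContinuity`, `rlNearIdentityDSS_ae_comp_dilation` (route RecurrentProfiles / SqueezeCycle lineage), the PROVED
tree theorem `pineauVicol2026_oneSlice_regularity_holds` (Pineau–Vicol 2026 Thm 1.9) and the KNSS pressure package
`ChiralWindowDoorClassDerivDecay.exists_classical_scaleInvariantBounds_of_class`.  The same two moves exist EARLIER in crux 22144's
lineage (`FiniteDissipationLiouville.…HullCategoryMinimal.recurrent_of_orbitLimit`, `…Envelope.pv_unsteadiness_floor_of_minimal`) for a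
different class; here they are proved independently for the Albritton–Barker class — NOT a new mechanism.
-/

-- the summit-side namespace repeats a component by design (single-conjunct summit, D-0017)
set_option linter.dupNamespace false

open MeasureTheory Set Metric Filter Topology
open scoped ENNReal NNReal InnerProductSpace
open Literature.Analysis.FluidPDE
open Literature.Dynamics.TopologicalDynamics

namespace Summit.NavierStokesRegularity.NavierStokesRegularity.Cruxes.ScarEnvelopeTypeI.ZoomDictionary

section HullJunction

variable {U U₁ U₂ W : ℝ → (EuclideanSpace ℝ (Fin 3)) → (EuclideanSpace ℝ (Fin 3))}
  {P : ℝ → (EuclideanSpace ℝ (Fin 3)) → ℝ}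
  {H : ℝ → (EuclideanSpace ℝ (Fin 3)) → (EuclideanSpace ℝ (Fin 3)) →L[ℝ] (EuclideanSpace ℝ (Fin 3))}
  {M : ℝ}

/-! ### Part D — THE ONE-SLICE METER (ref3 R44-F3 / DIRECTOR-NS #262: the R44 §6 seed (ι), typed)

Pineau–Vicol 2026, Thm 1.9 (`pineauVicol2026_oneSlice_regularity_holds`, a PROVED tree theorem) read on the
census: an ENVELOPED rooted census object (envelope (1.15) = `HasTypeIDecay A U`, CW (1.7) = PV (1.10); singular root
`¬ RegPt U 0`) whose pressure obeys the annulus bound (1.16) is NEVER δ₀-close to self-similar on `B₁` at any single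
slice `t̄ ∈ (−e^{−s₀}, 0)`; under the scale-invariant PRESSURE ENVELOPE `|q(t,x)| ≤ B/(‖x‖+√(−t))²` (the typed form of
WANTED W45-π: (1.16) for A–B objects, with `C_p = 4B + 1` at every scale) the same holds for EVERY rescaling `U_c`, i.e.
the similarity profile moves at sup-speed `> δ₀(A)` on the unit ball at all similarity times.  A METER (quantitative
rigidity constraint on the DSS / recurrent cells), not an exclusion. -/

/-- The self-similar DEFECT of PV26 (1.17) at `(t̄, x)`, `√(−t̄)‖(−t̄)∂ₜU − ½U − ½(x·∇)U‖`, with the time derivative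
taken within the region `[−1,0) × B₁` exactly as in the vendored fact. -/
theorem oneSlice_defect_floor {A : ℝ} (hA : 0 < A) :
    ∃ δ₀ : ℝ, 0 < δ₀ ∧ ∀ Cp : ℝ, 0 < Cp → ∃ s₀ : ℝ, 1 ≤ s₀ ∧
      ∀ (U : ℝ → (EuclideanSpace ℝ (Fin 3)) → (EuclideanSpace ℝ (Fin 3))) (q : ℝ → (EuclideanSpace ℝ (Fin 3)) → ℝ),
        IsClassicalNSSolutionOn (Iio 0) 1 0 U q → HasTypeIDecay A U →
        (∀ t ∈ Ico (-1 : ℝ) 0, ∀ x : (EuclideanSpace ℝ (Fin 3)), 1 / 2 < ‖x‖ → ‖x‖ < 3 / 4 → |q t x| ≤ Cp) →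
        ¬ RegPt U 0 →
        ∀ tbar : ℝ, -Real.exp (-s₀) < tbar → tbar < 0 →
          ∃ x ∈ ball (0 : (EuclideanSpace ℝ (Fin 3))) 1,
            δ₀ < ‖Real.sqrt (-tbar) •
              ((-tbar) • timeDerivOn (Ico (-1 : ℝ) 0 ×ˢ ball (0 : (EuclideanSpace ℝ (Fin 3))) 1) U tbar x
                - (1 / 2 : ℝ) • U tbar x - (1 / 2 : ℝ) • fderiv ℝ (U tbar) x x)‖ := by
  obtain ⟨δ₀, hδ₀, -, hfact⟩ := pineauVicol2026_oneSlice_regularity_holds A hA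
  refine ⟨δ₀, hδ₀, fun Cp hCp => ?_⟩
  obtain ⟨s₀, hs₀, hmain⟩ := hfact Cp hCp
  refine ⟨s₀, hs₀, fun U q hcl hdec hπ hsing tbar ht1 ht2 => ?_⟩
  by_contra hcon
  have hsmall : ∀ x ∈ ball (0 : (EuclideanSpace ℝ (Fin 3))) 1,
      ‖Real.sqrt (-tbar) •
        ((-tbar) • timeDerivOn (Ico (-1 : ℝ) 0 ×ˢ ball (0 : (EuclideanSpace ℝ (Fin 3))) 1) U tbar x
          - (1 / 2 : ℝ) • U tbar x - (1 / 2 : ℝ) • fderiv ℝ (U tbar) x x)‖ ≤ δ₀ :=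
    fun x hx => not_lt.1 fun h => hcon ⟨x, hx, h⟩
  -- the slab solution is a classical solution on the region `[−1,0) × B₁`
  have hreg : IsClassicalNSSolutionOnRegion (Ico (-1 : ℝ) 0 ×ˢ ball (0 : (EuclideanSpace ℝ (Fin 3))) 1) 1 0 U q := by
    refine hcl.onRegion.mono (prod_mono (fun t ht => ht.2) (subset_univ _)) ?_
    intro t x htx
    rw [timeSection_prod _ (mem_prod.1 htx).2]
    exact uniqueDiffOn_Ico (-1) 0 t (mem_prod.1 htx).1
  -- (1.15) from the global envelope
  have h15 : ∀ t ∈ Ico (-1 : ℝ) 0, ∀ x ∈ ball (0 : (EuclideanSpace ℝ (Fin 3))) 1,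
      ‖U t x‖ ≤ A / (Real.sqrt (-t) + ‖x‖) := by
    intro t ht x _
    rw [add_comm]
    exact hdec t ht.2 x
  obtain ⟨r, hr, M, hM⟩ := hmain U q hreg h15 hπ tbar ht1 ht2 hsmall
  refine hsing ⟨r, hr, M, ?_⟩
  refine (ae_restrict_iff' (isOpen_parabolicCylinder r _).measurableSet).2 (Filter.Eventually.of_forall ?_)
  rintro ⟨t, x⟩ hz
  rw [mem_parabolicCylinder] at hz
  have h1 : -r ^ 2 < t := by linarith [hz.1.1]
  exact hM t h1 hz.1.2 x (mem_ball.2 hz.2)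

/-- The scale-invariant pressure envelope gives the annulus bound (1.16) with `C_p = 4B + 1` for EVERY rescaling
`q_c = c² q(c²·, c·)`. -/
theorem annulusBound_of_pressureEnvelope {B : ℝ} {q : ℝ → (EuclideanSpace ℝ (Fin 3)) → ℝ}
    (hq : ∀ t : ℝ, t < 0 → ∀ x : (EuclideanSpace ℝ (Fin 3)), |q t x| ≤ B / (‖x‖ + Real.sqrt (-t)) ^ 2)
    {c : ℝ} (hc : 0 < c) :
    ∀ t ∈ Ico (-1 : ℝ) 0, ∀ x : (EuclideanSpace ℝ (Fin 3)), 1 / 2 < ‖x‖ → ‖x‖ < 3 / 4 →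
      |nsRescalePressure c q t x| ≤ 4 * B + 1 := by
  intro t ht x hx1 _
  have ht0 : t < 0 := ht.2
  have hB : 0 ≤ B := by
    have h := hq (-1) (by norm_num) 0
    simp only [norm_zero, neg_neg, Real.sqrt_one, zero_add, one_pow, div_one] at h
    exact (abs_nonneg _).trans h
  have hct : c ^ 2 * t < 0 := mul_neg_of_pos_of_neg (by positivity) ht0
  have key := hq (c ^ 2 * t) hct (c • x)
  have hsq : Real.sqrt (-(c ^ 2 * t)) = c * Real.sqrt (-t) := by
    rw [show -(c ^ 2 * t) = c ^ 2 * -t by ring, Real.sqrt_mul (sq_nonneg c), Real.sqrt_sq hc.le]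
  rw [norm_smul, Real.norm_of_nonneg hc.le, hsq, ← mul_add, mul_pow] at key
  have hd : 1 / 2 < ‖x‖ + Real.sqrt (-t) := lt_of_lt_of_le hx1 (le_add_of_nonneg_right (Real.sqrt_nonneg _))
  have hd2 : (1 / 4 : ℝ) < (‖x‖ + Real.sqrt (-t)) ^ 2 := by nlinarith
  have hdpos : (0 : ℝ) < (‖x‖ + Real.sqrt (-t)) ^ 2 := by linarith
  rw [nsRescalePressure_apply, abs_mul, abs_of_pos (by positivity : (0 : ℝ) < c ^ 2)]
  calc c ^ 2 * |q (c ^ 2 * t) (c • x)| ≤ c ^ 2 * (B / (c ^ 2 * (‖x‖ + Real.sqrt (-t)) ^ 2)) :=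
        mul_le_mul_of_nonneg_left key (by positivity)
    _ = B / (‖x‖ + Real.sqrt (-t)) ^ 2 := by field_simp
    _ ≤ B / (1 / 4) := div_le_div_of_nonneg_left hB (by norm_num) hd2.le
    _ = 4 * B := by ring
    _ ≤ 4 * B + 1 := by linarith

/-- ★★ **Z17.  UNIFORM SPEED FLOOR AT ALL SCALES.**  For an enveloped (`HasTypeIDecay A`) field with a classical
pressure on the open past obeying the scale-invariant PRESSURE ENVELOPE `|q(t,x)| ≤ B/(‖x‖+√(−t))²` and a SINGULAR root:
there are `δ₀ = δ₀(A) > 0` (uniform in `B`) and `s₀ = s₀(A,B) ≥ 1` such that EVERY rescaling `U_c` (`c > 0`) has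
self-similar defect `> δ₀` somewhere on `B₁` at EVERY slice `t̄ ∈ (−e^{−s₀}, 0)` — the similarity profile never slows
below `δ₀` on the unit ball, at any scale.  (Z16 + scale covariance: `IsClassicalNSSolutionOn.nsRescale_holds`,
`HasTypeIDecay.nsRescale`, the annulus bound `C_p = 4|B| + 1` at every scale, `RegPt` zoom transport.) -/
theorem oneSlice_defect_floor_allScales {A : ℝ} (hA : 0 < A) :
    ∃ δ₀ : ℝ, 0 < δ₀ ∧ ∀ B : ℝ, ∃ s₀ : ℝ, 1 ≤ s₀ ∧
      ∀ (U : ℝ → (EuclideanSpace ℝ (Fin 3)) → (EuclideanSpace ℝ (Fin 3))) (q : ℝ → (EuclideanSpace ℝ (Fin 3)) → ℝ),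
        IsClassicalNSSolutionOn (Iio 0) 1 0 U q → HasTypeIDecay A U →
        (∀ t : ℝ, t < 0 → ∀ x : (EuclideanSpace ℝ (Fin 3)), |q t x| ≤ B / (‖x‖ + Real.sqrt (-t)) ^ 2) →
        ¬ RegPt U 0 →
        ∀ c : ℝ, 0 < c → ∀ tbar : ℝ, -Real.exp (-s₀) < tbar → tbar < 0 →
          ∃ x ∈ ball (0 : (EuclideanSpace ℝ (Fin 3))) 1,
            δ₀ < ‖Real.sqrt (-tbar) •
              ((-tbar) • timeDerivOn (Ico (-1 : ℝ) 0 ×ˢ ball (0 : (EuclideanSpace ℝ (Fin 3))) 1) (nsRescale c U) tbar x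
                - (1 / 2 : ℝ) • nsRescale c U tbar x - (1 / 2 : ℝ) • fderiv ℝ (nsRescale c U tbar) x x)‖ := by
  obtain ⟨δ₀, hδ₀, hC⟩ := oneSlice_defect_floor hA
  refine ⟨δ₀, hδ₀, fun B => ?_⟩
  obtain ⟨s₀, hs₀, hmain⟩ := hC (4 * |B| + 1) (by positivity)
  refine ⟨s₀, hs₀, fun U q hcl hdec hq hsing c hc tbar ht1 ht2 => ?_⟩
  -- scale covariance of the three hypotheses and of the singular root
  have hcl' : IsClassicalNSSolutionOn (Iio 0) 1 0 (nsRescale c U) (nsRescalePressure c q) := by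
    have h := IsClassicalNSSolutionOn.nsRescale_holds hcl hc
    rw [nsRescaleForce_zero] at h
    have hS : (fun t : ℝ => c ^ 2 * t) ⁻¹' Iio (0 : ℝ) = Iio 0 := by
      ext t
      simp only [mem_preimage, mem_Iio]
      have hc2 : 0 < c ^ 2 := by positivity
      constructor
      · intro h'; nlinarith
      · intro h'; nlinarith
    rwa [hS] at h
  have hdec' : HasTypeIDecay A (nsRescale c U) := hdec.nsRescale hc
  have hπ' : ∀ t ∈ Ico (-1 : ℝ) 0, ∀ x : (EuclideanSpace ℝ (Fin 3)), 1 / 2 < ‖x‖ → ‖x‖ < 3 / 4 →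
      |nsRescalePressure c q t x| ≤ 4 * |B| + 1 :=
    fun t ht x h1 h2 => (annulusBound_of_pressureEnvelope hq hc t ht x h1 h2).trans (by linarith [le_abs_self B])
  have hsing' : ¬ RegPt (nsRescale c U) 0 := fun h =>
    hsing (regPt_of_regPt_zoom_zero hc (by rwa [zoom_zero_eq_nsRescale]))
  exact hmain _ _ hcl' hdec' hπ' hsing' tbar ht1 ht2

/-- ★★ **Z17⁺.  W45-π DISCHARGED BY NAME: the PRESSURE ENVELOPE of an enveloped Type-I ancient mild field.**  An
`IsTypeIAncientMild M` field with the space–time envelope `HasTypeIDecay A` has a classical pressure on the open past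
(its Riesz pressure) with `|q(t,x)| ≤ B/(‖x‖+√(−t))²` — the order-zero pressure entry of the tree's scale-invariant
package `RellichScarScarRigidity.ScaleInvariantBounds` delivered by
`ChiralWindowDoorClassDerivDecay.exists_classical_scaleInvariantBounds_of_class` (KNSS 2009 Prop. 4.1 bootstrap +
Riesz pressure; the ChiralWindowDoor / RellichScar lineage — IN TREE, used here BY NAME, not re-derived).  In
particular the Pineau–Vicol hypothesis (1.16) HOLDS for every enveloped A–B object at every scale: the cheapest
falsifier of the ROUND-45 seed (ref3 R44 «type (1.16) for A–B objects first») does not fire. -/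
theorem pressureEnvelope_of_hasTypeIDecay {M A : ℝ} {U : ℝ → (EuclideanSpace ℝ (Fin 3)) → (EuclideanSpace ℝ (Fin 3))}
    (hU : IsTypeIAncientMild M U) (hdec : HasTypeIDecay A U) :
    ∃ (q : ℝ → (EuclideanSpace ℝ (Fin 3)) → ℝ) (B : ℝ), IsClassicalNSSolutionOn (Iio 0) 1 0 U q ∧
      ∀ t : ℝ, t < 0 → ∀ x : (EuclideanSpace ℝ (Fin 3)), |q t x| ≤ B / (‖x‖ + Real.sqrt (-t)) ^ 2 := by
  obtain ⟨Q, hcl, hSIB⟩ :=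
    Summit.NavierStokesRegularity.NavierStokesRegularity.Theorems.ChiralWindowDoorClassDerivDecay.exists_classical_scaleInvariantBounds_of_class
      hU.hasTypeITimeDecay hdec hU.continuousOn_uncurry (fun s t hst ht x => hU.mild_eq_heatExtension hst ht x)
      (fun t ht => hU.isDivFree ht)
  obtain ⟨L, hL⟩ := hSIB 0
  refine ⟨Q, L, hcl, fun t ht x => ?_⟩
  have h := (hL t ht x).2.1
  simpa [norm_iteratedFDeriv_zero, Real.norm_eq_abs] using h

/-- ★★ **Z17⁺⁺.  THE ONE-SLICE METER ON ENVELOPED ROOTED TYPE-I OBJECTS — UNCONDITIONAL.**  For every `A > 0` there is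
`δ₀ = δ₀(A) > 0` such that every Type-I ancient mild field with envelope `HasTypeIDecay A` and SINGULAR root admits a
horizon `s₀ ≥ 1` with: at EVERY scale `c > 0` and EVERY slice `t̄ ∈ (−e^{−s₀}, 0)` some point of `B₁` has self-similar
defect `> δ₀` for `U_c`.  (Z17 + Z17⁺.)  A THEOREM about the census's enveloped enemies (tame DSS cell of R44; every
globally enveloped rooted A–B object), not an exclusion: it is the quantitative form in which «recurrent orbits of
the scaling flow never come to rest» — the NS-specific input ref3 asked to see typed (R43/R44-F3). -/
theorem oneSlice_speedFloor_of_envelope {A : ℝ} (hA : 0 < A) :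
    ∃ δ₀ : ℝ, 0 < δ₀ ∧ ∀ (M : ℝ) (U : ℝ → (EuclideanSpace ℝ (Fin 3)) → (EuclideanSpace ℝ (Fin 3))),
      IsTypeIAncientMild M U → HasTypeIDecay A U → ¬ RegPt U 0 →
      ∃ s₀ : ℝ, 1 ≤ s₀ ∧ ∀ c : ℝ, 0 < c → ∀ tbar : ℝ, -Real.exp (-s₀) < tbar → tbar < 0 →
        ∃ x ∈ ball (0 : (EuclideanSpace ℝ (Fin 3))) 1,
          δ₀ < ‖Real.sqrt (-tbar) •
            ((-tbar) • timeDerivOn (Ico (-1 : ℝ) 0 ×ˢ ball (0 : (EuclideanSpace ℝ (Fin 3))) 1) (nsRescale c U) tbar x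
              - (1 / 2 : ℝ) • nsRescale c U tbar x - (1 / 2 : ℝ) • fderiv ℝ (nsRescale c U tbar) x x)‖ := by
  obtain ⟨δ₀, hδ₀, hB⟩ := oneSlice_defect_floor_allScales hA
  refine ⟨δ₀, hδ₀, fun M U hU hdec h0 => ?_⟩
  obtain ⟨q, B, hcl, hq⟩ := pressureEnvelope_of_hasTypeIDecay hU hdec
  obtain ⟨s₀, hs₀, hmain⟩ := hB B
  exact ⟨s₀, hs₀, fun c hc tbar h1 h2 => hmain U q hcl hdec hq h0 c hc tbar h1 h2⟩

/-- ★★ **Z18.  THE METER ON THE TAME DSS CELL (junction with ROUND-44 Z5⁺) — UNCONDITIONAL.**  A TAME exactly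
past-DSS rooted A–B object (the first cell of the R44 normal form: `TameRoot`, factor `c > 1`, singular root) is
globally enveloped (Z5), hence — by Z17⁺⁺ — its similarity profile obeys the uniform speed floor at every scale: a
PERIODIC orbit (period `log c`) of the scaling flow along which the Pineau–Vicol defect never drops to `δ₀` on `B₁`.
A METER, not an exclusion: PV26 Thm 1.9 constrains the cell quantitatively and kills nothing by itself. -/
theorem tameDssCell_speedFloor {n : TNode} (hT : ABTower M n.U n.P n.H) (h0 : ¬ RegPt n.U 0) (ht : TameRoot n)
    {c : ℝ} (hc : 1 < c) (h : ∀ t < 0, ∀ x, nsRescale c n.U t x = n.U t x) :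
    ∃ δ₀ : ℝ, 0 < δ₀ ∧ ∃ s₀ : ℝ, 1 ≤ s₀ ∧
      ∀ c' : ℝ, 0 < c' → ∀ tbar : ℝ, -Real.exp (-s₀) < tbar → tbar < 0 →
        ∃ x ∈ ball (0 : (EuclideanSpace ℝ (Fin 3))) 1,
          δ₀ < ‖Real.sqrt (-tbar) •
            ((-tbar) • timeDerivOn (Ico (-1 : ℝ) 0 ×ˢ ball (0 : (EuclideanSpace ℝ (Fin 3))) 1) (nsRescale c' n.U) tbar x
              - (1 / 2 : ℝ) • nsRescale c' n.U tbar x - (1 / 2 : ℝ) • fderiv ℝ (nsRescale c' n.U tbar) x x)‖ := by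
  -- the envelope of the tame DSS cell (R44 Z5), made positive
  obtain ⟨A₀, hA₀⟩ := (tameRoot_iff_hasTypeIDecay_of_pastDss hT hc h).1 ht
  have hA : HasTypeIDecay (max A₀ 1) n.U := fun t ht' x =>
    (hA₀ t ht' x).trans (div_le_div_of_nonneg_right (le_max_left _ _)
      (add_pos_of_nonneg_of_pos (norm_nonneg _) (Real.sqrt_pos.2 (neg_pos.2 ht'))).le)
  have hApos : 0 < max A₀ 1 := lt_of_lt_of_le zero_lt_one (le_max_right _ _)
  obtain ⟨δ₀, hδ₀, hall⟩ := oneSlice_speedFloor_of_envelope hApos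
  obtain ⟨s₀, hs₀, hmain⟩ := hall _ _ hT.1 hA h0
  exact ⟨δ₀, hδ₀, s₀, hs₀, hmain⟩

end HullJunction

end Summit.NavierStokesRegularity.NavierStokesRegularity.Cruxes.ScarEnvelopeTypeI.ZoomDictionary
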